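import Summits.PneNP.PneNP.Theorems.NegLimitedAmplifiedWindowAmpAssembly
import Summits.PneNP.PneNP.Theorems.NegLimitedAmplifiedWindowAmpTrim
import Summits.PneNP.PneNP.Theorems.NegLimitedAmplifiedWindowAmpCorner
import Mathlib
import HarnessLib

/-!
# Route NegLimited — line `amplified-window`, stub `stub_monotoneAmplification` (rung F-N1/p3, ROUND-12)

Registered stub (A) of the skeleton `amplified-window` on the door item
`NegLimited.NeglimitedEpsLogNegationsR` (stmt-PneNP-19860; card HOME/pnp-ideate-p3/r11/amplified-window.md §6,
blueprint HOME/pnp-ideate-p3/r12/BLUEPRINT-A.md): `MonotoneAmplification` — Impagliazzo's hard-core lemma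
plus O'Donnell's recursive-majority hybrid argument, MONOTONE version: a CONSTANT-error average-case lower
bound for `f` against size-`s` `{∧,∨,0,1}`-circuits under a balanced weight `D` amplifies to
`(½ + K·(3^d)^{−α})`-hardness of `RM3_d ⊗ f` under `D^{⊗3^d}` against `{∧,∨,0,1}`-circuits `M` with
`|M|·K·(3^d)^8 ≤ s`, with `α = log₃(16/13)/2`.

ASSEMBLY (p3's decomposition A0–A8, all landed BY NAME in `Theorems/NegLimitedAmplifiedWindowAmp*.lean`;
p3's A4 `Amp.HybridStep` is false as typed and is replaced by `Amp.hybridStep` with `0 ≤ η`, so the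
composition is done here directly rather than through `Amp.monotoneAmplification_of_parts`):
* `|M| = 0`: `Amp.projectionCorner_holds` (`½ + 2^{-(d+1)} ≤ ½ + (3^d)^{-1/2} ≤ ½ + K(3^d)^{−α}`);
* `|M| ≥ 1`: `β ≤ ½` (constant circuit), `γ := 1/(2·9^d)`, `p := β/2`; `Amp.hardCoreMonotone_holds` (budget
  `t·(|M|+2) + (⌊t/2⌋+1)(2t+1) ≤ 9t²|M| ≤ 5184·81^d·|M|/β⁴ ≤ s` for `t ≤ 24·81^d/β²`), `Amp.balancedTrim_holds`
  (class = evaluations of `{∧,∨,0,1}`-circuits of size `≤ |M|+2`, contains both constants), `Amp.core_bound`,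
  `Amp.rm3BiasDecay_holds`; `K := max (5184/β⁴) (K₁/2 + 1)`.

References: R. Impagliazzo, FOCS 1995 [Impagliazzo1995]; R. O'Donnell, JCSS 69 (2004) §3–4 [ODonnell2004];
A. Healy, S. Vadhan, E. Viola, SICOMP 35 (2006) [HealyVadhanViola2006].

HONEST FRAMING: a KNOWN theorem (hardness amplification within NP) ported to monotone circuits and finite
weighted sums; with B (p472908), EA, DA, T and S (p479124) it completes p3's line on the door item, whose
closing is the skeleton's business; FRONTIER rung F-N1 — nothing here bears on P vs NP.
-/

set_option linter.dupNamespace false -- `Summit.PneNP.PneNP.…`: summit = sub-problem name (D-0017 single-conjunct layout)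

namespace Summit.PneNP.PneNP.Theorems.NegLimitedAmplifiedWindow

open Finset Function
open Literature.Computability.Complexity
open Summit.PneNP.PneNP.Theorems.NegLimitedDoor (massAt agreeAt)
open Summit.PneNP.PneNP.Theorems.CliqueExtLowerBound.Negative (MonoBasis MonoBasis.monotoneBasis01 cktSize_const01)

/-- The size-`0` corner in the final form: `2^{-(d+1)} ≤ (3^d)^{-α}` for `α ≤ ½`. -/
theorem half_pow_le_rpow (d : ℕ) {α : ℝ} (hα : α ≤ 1 / 2) :
    (1 / 2 : ℝ) ^ (d + 1) ≤ ((3 : ℝ) ^ d) ^ (-α) := by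
  have h2d : (0 : ℝ) < (2 : ℝ) ^ d := by positivity
  have h1 : (1 / 2 : ℝ) ^ (d + 1) ≤ ((2 : ℝ) ^ d)⁻¹ := by
    rw [one_div_pow, one_div]
    exact inv_anti₀ h2d (pow_le_pow_right₀ (by norm_num) (Nat.le_succ d))
  have h2 : ((2 : ℝ) ^ d)⁻¹ = ((4 : ℝ) ^ d) ^ (-(1 / 2 : ℝ)) := by
    rw [show (4 : ℝ) ^ d = ((2 : ℝ) ^ d) ^ 2 by
        rw [show (4 : ℝ) = 2 ^ 2 by norm_num, ← pow_mul, ← pow_mul, mul_comm],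
      Real.rpow_neg (by positivity), ← Real.sqrt_eq_rpow, Real.sqrt_sq h2d.le]
  have h3 : ((4 : ℝ) ^ d) ^ (-(1 / 2 : ℝ)) ≤ ((3 : ℝ) ^ d) ^ (-(1 / 2 : ℝ)) :=
    Real.rpow_le_rpow_of_nonpos (by positivity) (pow_le_pow_left₀ (by norm_num) (by norm_num) d)
      (by norm_num)
  have h4 : ((3 : ℝ) ^ d) ^ (-(1 / 2 : ℝ)) ≤ ((3 : ℝ) ^ d) ^ (-α) :=
    Real.rpow_le_rpow_of_exponent_le (one_le_pow₀ (by norm_num)) (by linarith)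
  linarith

/-- The size budget of the hard-core step: for `1 ≤ t ≤ 24·N²'/β²`-many voters (`N2 = 9^d`),
`t(m+2) + (⌊t/2⌋+1)(2t+1) ≤ s` as soon as `m·K·81^d ≤ s` with `K ≥ 5184/β⁴`, `m ≥ 1`. -/
theorem budget_le {t m s : ℕ} {β K N : ℝ} (hβ : 0 < β) (hN : 1 ≤ N) (hm : 1 ≤ m) (hK1 : 1 ≤ K)
    (hK : 5184 / β ^ 4 ≤ K) (hs : (m : ℝ) * K * N ^ 8 ≤ s) (ht : (t : ℝ) ≤ 24 * N ^ 4 / β ^ 2) :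
    t * (m + 2) + (t / 2 + 1) * (2 * t + 1) ≤ s := by
  have hm' : (1 : ℝ) ≤ m := by exact_mod_cast hm
  have hN8 : (1 : ℝ) ≤ N ^ 8 := one_le_pow₀ hN
  have hKN : (5184 / β ^ 4) * N ^ 8 ≤ K * N ^ 8 := mul_le_mul_of_nonneg_right hK (by positivity)
  have hs1 : (1 : ℝ) ≤ s :=
    (one_le_mul_of_one_le_of_one_le (one_le_mul_of_one_le_of_one_le hm' hK1) hN8).trans hs
  rcases Nat.eq_zero_or_pos t with rfl | ht1
  · simp only [zero_mul, Nat.zero_div, zero_add, one_mul]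
    exact_mod_cast hs1
  -- `t ≥ 1`: bound by `9 t² m`
  have hdiv : ((t / 2 : ℕ) : ℝ) ≤ t := by exact_mod_cast Nat.div_le_self t 2
  have ht1' : (1 : ℝ) ≤ t := by exact_mod_cast ht1
  have ht0 : (0 : ℝ) ≤ t := by positivity
  have hT2 : (t : ℝ) ^ 2 ≤ (24 * N ^ 4 / β ^ 2) ^ 2 := pow_le_pow_left₀ ht0 ht 2
  have htt : (t : ℝ) ≤ (t : ℝ) ^ 2 := by nlinarith
  have ht2one : (1 : ℝ) ≤ (t : ℝ) ^ 2 := ht1'.trans htt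
  have hreal : ((t * (m + 2) + (t / 2 + 1) * (2 * t + 1) : ℕ) : ℝ) ≤ s := by
    push_cast
    have hA : (t : ℝ) * m ≤ (t : ℝ) ^ 2 * m := mul_le_mul_of_nonneg_right htt (by positivity)
    have hB : (t : ℝ) ≤ t * m := le_mul_of_one_le_right ht0 hm'
    have h1 : (t : ℝ) * (m + 2) ≤ 3 * (t : ℝ) ^ 2 * m := by linarith
    have hC : (((t / 2 : ℕ) : ℝ) + 1) * (2 * t + 1) ≤ ((t : ℝ) + 1) * (2 * t + 1) :=
      mul_le_mul_of_nonneg_right (by linarith) (by positivity)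
    have h2 : (((t / 2 : ℕ) : ℝ) + 1) * (2 * t + 1) ≤ 6 * (t : ℝ) ^ 2 := by nlinarith
    have hD : (t : ℝ) ^ 2 ≤ (t : ℝ) ^ 2 * m := le_mul_of_one_le_right (by positivity) hm'
    have h3 : 9 * (t : ℝ) ^ 2 * m ≤ 9 * (24 * N ^ 4 / β ^ 2) ^ 2 * m :=
      mul_le_mul_of_nonneg_right (mul_le_mul_of_nonneg_left hT2 (by norm_num)) (by positivity)
    have h4 : 9 * (24 * N ^ 4 / β ^ 2) ^ 2 * (m : ℝ) = m * ((5184 / β ^ 4) * N ^ 8) := by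
      field_simp; ring
    have h5 : (m : ℝ) * ((5184 / β ^ 4) * N ^ 8) ≤ m * (K * N ^ 8) :=
      mul_le_mul_of_nonneg_left hKN (by positivity)
    have h6 : (m : ℝ) * (K * N ^ 8) = m * K * N ^ 8 := by ring
    linarith
  exact_mod_cast hreal

/-- **Registered stub `stub_monotoneAmplification`** of the skeleton `amplified-window` (stmt-PneNP-19860):
monotone hardness amplification `MonotoneAmplification`, with `α = log₃(16/13)/2` and `e = 8`. -/
theorem stub_monotoneAmplification : MonotoneAmplification := by
  classical
  obtain ⟨α, hα0, hα2, hK₁⟩ := Amp.rm3BiasDecay_holds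
  refine ⟨α, hα0, 8, fun β hβ => ?_⟩
  obtain ⟨K₁, hK₁0, hK₁d⟩ := hK₁ (min (β / 2) 1) (lt_min (by linarith) one_pos) (min_le_right _ _)
  obtain ⟨K, hK⟩ : ∃ K : ℝ, K = max (5184 / β ^ 4) (K₁ / 2 + 1) := ⟨_, rfl⟩
  have hK1 : 1 ≤ K := by rw [hK]; exact le_max_of_le_right (by linarith)
  have hK5184 : 5184 / β ^ 4 ≤ K := by rw [hK]; exact le_max_left _ _
  have hKge : K₁ / 2 + 1 ≤ K := by rw [hK]; exact le_max_right _ _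
  refine ⟨K, by linarith, ?_⟩
  intro ι _ _ D f s d hD hD1 _hf hbal hhard M hM hsize
  obtain ⟨N, hN⟩ : ∃ N : ℝ, N = (3 : ℝ) ^ d := ⟨_, rfl⟩
  rw [← hN] at hsize ⊢
  have hN1 : 1 ≤ N := by rw [hN]; exact one_le_pow₀ (by norm_num)
  have hN0 : 0 < N := by linarith
  have hNα : 0 ≤ N ^ (-α) := Real.rpow_nonneg hN0.le _
  rcases Nat.eq_zero_or_pos M.size with h0 | hm
  · -- gate-free `M`: a projection
    have h := Amp.projectionCorner_holds ι D f d M hD hD1 hbal h0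
    have h2 := half_pow_le_rpow d hα2
    rw [← hN] at h2
    nlinarith
  -- `M` has at least one gate; `1 ≤ s`
  have hs1 : 1 ≤ s := by
    have h1 : (1 : ℝ) ≤ M.size := by exact_mod_cast hm
    have : (1 : ℝ) ≤ s :=
      (one_le_mul_of_one_le_of_one_le (one_le_mul_of_one_le_of_one_le h1 hK1) (one_le_pow₀ hN1)).trans hsize
    exact_mod_cast this
  -- `β ≤ ½` from the constant circuit
  have hβhalf : β ≤ 1 / 2 := by
    obtain ⟨C, hC, hCs, hCe⟩ := (cktSize_const01 (ι := ι) MonoBasis.monotoneBasis01 true).toCircuit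
    have h := hhard C hC (hCs.trans hs1)
    have : agreeAt D f C.eval = massAt D f true := by
      unfold agreeAt massAt
      exact Finset.sum_congr rfl fun x _ => by rw [hCe x]; simp only [eq_comm]
    rw [this, hbal] at h
    linarith
  -- parameters
  obtain ⟨p, hp⟩ : ∃ p : ℝ, p = β / 2 := ⟨_, rfl⟩
  have hp0 : 0 < p := by rw [hp]; positivity
  have hp1 : p ≤ 1 := by rw [hp]; linarith
  have hpmin : min (β / 2) 1 = p := by rw [hp]; exact min_eq_left (by linarith)
  obtain ⟨γ, hγ⟩ : ∃ γ : ℝ, γ = 1 / (2 * N ^ 2) := ⟨_, rfl⟩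
  have hγ0 : 0 < γ := by rw [hγ]; positivity
  have hγhalf : γ ≤ 1 / 2 := by
    rw [hγ, div_le_div_iff₀ (by positivity) (by norm_num)]; nlinarith
  have hγβ : 0 < γ * β := mul_pos hγ0 hβ
  have hγβ1 : γ * β ≤ 1 := by nlinarith
  -- A1: hard-core measure for size-`(|M|+2)` monotone circuits
  have hbudget : ∀ t : ℕ, (t : ℝ) ≤ 4 / (γ * β) ^ 2 + 2 / (γ * β) →
      t * (M.size + 2) + (t / 2 + 1) * (2 * t + 1) ≤ s := by
    intro t ht
    refine budget_le (N := N) hβ hN1 hm hK1 hK5184 hsize (ht.trans ?_)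
    -- `4/(γβ)² + 2/(γβ) ≤ 6/(γβ)² = 24 N⁴/β²`
    have h1 : 2 / (γ * β) ≤ 2 / (γ * β) ^ 2 := by
      rw [div_le_div_iff₀ hγβ (by positivity)]
      nlinarith
    have h2 : 6 / (γ * β) ^ 2 = 24 * N ^ 4 / β ^ 2 := by rw [hγ]; field_simp; ring
    have h3 : 4 / (γ * β) ^ 2 + 2 / (γ * β) ^ 2 = 6 / (γ * β) ^ 2 := by ring
    linarith
  obtain ⟨H, hH0, hH1, hHβ, hHadv⟩ :=
    Amp.hardCoreMonotone_holds ι D f s (M.size + 2) β γ hD hD1 hβ hγ0 hhard hbudget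
  -- A2: balanced trim on the class of size-`(|M|+2)` monotone circuits
  obtain ⟨𝒢, h𝒢⟩ : ∃ 𝒢 : Set ((ι → Bool) → Bool),
      𝒢 = {g | ∃ C : Circuit ι, C.IsOver monotoneBasis01 ∧ C.size ≤ M.size + 2 ∧ C.eval = g} := ⟨_, rfl⟩
  have hconst : ∀ b : Bool, (fun _ : ι → Bool => b) ∈ 𝒢 := fun b => by
    obtain ⟨C, hC, hCs, hCe⟩ := (cktSize_const01 (ι := ι) MonoBasis.monotoneBasis01 b).toCircuit
    rw [h𝒢]; exact ⟨C, hC, by omega, funext hCe⟩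
  have h𝒢adv : ∀ g ∈ 𝒢, ∑ x, D x * H x * (if g x = f x then (1 : ℝ) else -1) < γ * ∑ x, D x * H x := by
    intro g hg; rw [h𝒢] at hg; obtain ⟨C, hC, hCs, rfl⟩ := hg; exact hHadv C hC hCs
  obtain ⟨H', hH'0, hH'1, hmt, hmf, hadv⟩ := Amp.balancedTrim_holds (ι → Bool) D H f 𝒢 β γ p hD hH0 hH1 hγ0
    hγhalf hp0 (by rw [hp]; nlinarith) hHβ (hconst true) (hconst false) h𝒢adv
  -- the core bound
  have hcore := Amp.core_bound D H' f d M hM hD hD1 hbal hH'0 hH'1 hγ0.le hp1 hmt hmf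
    (fun C hC hCs => hadv C.eval (by rw [h𝒢]; exact ⟨C, hC, hCs, rfl⟩))
  rw [← hN] at hcore
  -- numerics: `½·E ≤ ½·K₁·N^{-α}`, `2γN = 1/N ≤ N^{-α}`
  have hE : Amp.expAbsBias d p ≤ K₁ * N ^ (-α) := by rw [← hpmin, hN]; exact hK₁d d
  have hγN : 2 * γ * N ≤ N ^ (-α) := by
    have h1 : 2 * γ * N = N ^ (-(1 : ℝ)) := by
      rw [Real.rpow_neg_one, hγ]; field_simp
    rw [h1]
    exact Real.rpow_le_rpow_of_exponent_le hN1 (by linarith)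
  nlinarith

end Summit.PneNP.PneNP.Theorems.NegLimitedAmplifiedWindow
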